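import Summits.BirchSwinnertonDyer.BirchSwinnertonDyer.Theorems.InertBadSignedBranchesKFormConsumers
import HarnessLib

/-!
# Route `InertBadSignedBranches` (rung K8): the CLASS / BRIDGE shape in Kobayashi's (K)-form —
# the crux `CccOneLawOnTypeIstarZero` + `PublishedFactsInert` + (K)-form (C1_η)-CM + the two named
# facts ⟹ `BSDp` and `LowerHalfOnType p I₀*` on the signed type, with NO (F)-form binder

Cell `b2b-bsdres`, unit `b2b-bsdres-x1b` (gen 47); sequel of `…KFormConsumers.lean` (same session),
answering the second half of planner D85 («+ the matching bridge variant»). HONEST FRAMING (verbatim in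
every file of the cell): tool theorems only, CONDITIONAL on every displayed hypothesis; the K8 crux, (C1_η)
in any form, and the leaf `X12.CMInertBad` are NOT claimed; nothing booked; no label moves.
* `bsdpOnType_of_cccOneLawOnTypeIstarZero_of_etaEvenMC` — `h₁ : CccOneLawOnTypeIstarZero`,
  `h₆ : PublishedFactsInert`, `hKO` (Kitajima–Otsuki Main Thm 1.3), `h74` (Kobayashi Thm 7.4 at η), and
  `hC1K` (the (K)-form even main conjecture at `η` for CM curves = the candidate restated conjunct 1 of
  `PrintReadingsInert`) ⟹ `∀ p ≥ 5, ∀ W` of signed type `(p, I₀*)` with `r_an = 1`, `BSDp W p` — exactly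
  the input the bridge `CMRungInputs.cmInertBad_of_inputs` extracts from `(h₁, h₅, h₆)` on this type, with
  `h₅` replaced by `(hKO, h74, hC1K)`;
* `lowerHalfOnType_IstarZero_of_cccOneLawOnTypeIstarZero_of_etaEvenMC` — the O10-PS class target
  `X12.O10.LowerHalfOnType p I₀*` from the same.
References: S. Kobayashi, Invent. Math. 152 (2003) §4 (p. 8), Thm. 7.4 (p. 13); T. Kitajima, R. Otsuki,
Tokyo J. Math. 41 (2018) Main Thm. 1.3; HOME `b2b-bsdres-x1b/X12-ROUTE.md` §51.
-/

set_option autoImplicit false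
set_option linter.dupNamespace false

noncomputable section

open scoped Classical

open CongruenceSubgroup Field Function NumberField IsDedekindDomain WeierstrassCurve
open Literature.NumberTheory.EllipticCurves
open Literature.NumberTheory.EllipticCurves.ModularForms
open Literature.NumberTheory.EllipticCurves.Rank1Residual
open Literature.NumberTheory.EllipticCurves.Rank1Residual.Typed
open Literature.NumberTheory.GaloisRepresentations
open Literature.NumberTheory.GaloisCohomology
open ZpExtension
open Summit.BirchSwinnertonDyer.Rank1Residual Summit.BirchSwinnertonDyer.Rank1Residual.Additive
open Summit.BirchSwinnertonDyer.Rank1Residual.X12.O10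

/-! ## §5 CLASS / BRIDGE SHAPE: the K8 crux + the (K)-form readings ⟹ `BSDp` on the type -/

namespace Summit.BirchSwinnertonDyer.BirchSwinnertonDyer.Theorems.KFormReadings

open Summit.BirchSwinnertonDyer.BirchSwinnertonDyer.Theses.InertBadSignedBranches

/-- **BRIDGE INGREDIENT IN (K)-FORM.** The K8 crux `CccOneLawOnTypeIstarZero` (C-cc-1 on the type, `h₁`),
the route's `PublishedFactsInert` (`h₆`: hmod, hGZ, hGZK, hPT, hnf, hM), the NAMED FACTS `hKO h74`, and the
(K)-form even main conjecture at `η` for CM curves (`hC1K` — the candidate restated conjunct 1 of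
`PrintReadingsInert`, planner D85) give `BSD(W, p)` for EVERY globally minimal `W` of signed type
`(p, I₀*)` with `r_an = 1`, `p ≥ 5` — i.e. exactly what the bridge `CMRungInputs.cmInertBad_of_inputs`
extracts from `(h₁, h₅, h₆)` on this type, with `h₅` replaced by `(hKO, h74, hC1K)`. CONDITIONAL; nothing
booked; the leaf `X12.CMInertBad` is NOT concluded here (the residual conjuncts `InertBadOffType`,
`InertBadAtThree` are untouched). [cite: Kobayashi2003, §4 (p. 8), Thm. 7.4 (p. 13)]
[cite: KitajimaOtsuki2018, Main Thm. 1.3] [cite: Miller2011LMS, §1 and Def. 1.1] -/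
theorem bsdpOnType_of_cccOneLawOnTypeIstarZero_of_etaEvenMC
    (h₁ : CccOneLawOnTypeIstarZero) (h₆ : PublishedFactsInert)
    (hKO : Literature.NumberTheory.EllipticCurves.KitajimaOtsuki2018.mainThm13_etaSignedSelmerDual_noFiniteSubmodule)
    (h74 : Literature.NumberTheory.EllipticCurves.Kobayashi2003.thm74_etaEvenMC_iff_etaOddMC)
    (hC1K : ∀ (p : ℕ) [Fact p.Prime], 5 ≤ p →
      ∀ (K₀ : Type) [Field K₀] [NumberField K₀] [IsCyclotomicExtension {p} ℚ K₀]
        [(galRange (K := ℚ) K₀).Normal] (η : absoluteGaloisGroup ℚ →* ℤˣ),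
        (∀ σ ∈ galRange (K := ℚ) K₀, η σ = 1) → η ≠ 1 →
      ∀ (V : WeierstrassCurve ℚ) [V.IsElliptic] [V.IsGloballyMinimal] {N : ℕ} [NeZero N]
        {f : CuspForm (Gamma0 N) 2}, V.HasCM →
        p ≠ 2 → V.HasGoodReductionAtPrime p → V.frobeniusTrace p = 0 → IsNewformOf V f →
      ∀ (ϖ : ℚ), (if Even (p / 2) then (ϖ : ℝ) * V.realPeriodRat = plusPeriod f
          else (ϖ : ℝ) * V.imaginaryPeriodRat = minusPeriod f) →
      ∀ (κ : ZpExtension ℚ p) (γ : absoluteGaloisGroup ℚ),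
        κ.IsCyclotomic → κ.IsTopGenerator γ → γ ∈ galRange (K := ℚ) K₀ → IsCyclotomicVariable p γ →
      ∀ (Lp : IwasawaAlgebra p), IsQuadraticBranchPlusLFunction f p ϖ Lp →
      ∀ D : EtaSignedSelmerDualData V κ K₀ ℚ_[p] η γ 1, D.charIdeal = Ideal.span {Lp})
    (p : ℕ) [Fact p.Prime] (hp5 : 5 ≤ p)
    (W : WeierstrassCurve ℚ) [W.IsElliptic] [W.IsGloballyMinimal]
    (hT : HasSignedLocalType W p (.Istar 0)) (hr : W.analyticRank = 1) : BSDp W p := by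
  obtain ⟨hmod, hGZ, hGZK, hPT, hnf, hM⟩ := h₆
  exact bsdp_of_hasSignedLocalType_IstarZero_of_valuation_of_etaEvenMC W p hmod hGZ hGZK hPT hnf hM hKO h74
    hC1K (h₁ p hp5 W hT hr) hT hr hp5

/-- **The O10-PS class target in (K)-form**: `X12.O10.LowerHalfOnType p I₀*` for `p ≥ 5` from the K8 crux
`h₁`, `PublishedFactsInert`, `hKO h74` and `hC1K`. CONDITIONAL; nothing booked.
[cite: Kobayashi2003, §4 (p. 8), Thm. 7.4 (p. 13)] [cite: Miller2011LMS, §1 and Def. 1.1] -/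
theorem lowerHalfOnType_IstarZero_of_cccOneLawOnTypeIstarZero_of_etaEvenMC
    (h₁ : CccOneLawOnTypeIstarZero) (h₆ : PublishedFactsInert)
    (hKO : Literature.NumberTheory.EllipticCurves.KitajimaOtsuki2018.mainThm13_etaSignedSelmerDual_noFiniteSubmodule)
    (h74 : Literature.NumberTheory.EllipticCurves.Kobayashi2003.thm74_etaEvenMC_iff_etaOddMC)
    (hC1K : ∀ (p : ℕ) [Fact p.Prime], 5 ≤ p →
      ∀ (K₀ : Type) [Field K₀] [NumberField K₀] [IsCyclotomicExtension {p} ℚ K₀]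
        [(galRange (K := ℚ) K₀).Normal] (η : absoluteGaloisGroup ℚ →* ℤˣ),
        (∀ σ ∈ galRange (K := ℚ) K₀, η σ = 1) → η ≠ 1 →
      ∀ (V : WeierstrassCurve ℚ) [V.IsElliptic] [V.IsGloballyMinimal] {N : ℕ} [NeZero N]
        {f : CuspForm (Gamma0 N) 2}, V.HasCM →
        p ≠ 2 → V.HasGoodReductionAtPrime p → V.frobeniusTrace p = 0 → IsNewformOf V f →
      ∀ (ϖ : ℚ), (if Even (p / 2) then (ϖ : ℝ) * V.realPeriodRat = plusPeriod f
          else (ϖ : ℝ) * V.imaginaryPeriodRat = minusPeriod f) →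
      ∀ (κ : ZpExtension ℚ p) (γ : absoluteGaloisGroup ℚ),
        κ.IsCyclotomic → κ.IsTopGenerator γ → γ ∈ galRange (K := ℚ) K₀ → IsCyclotomicVariable p γ →
      ∀ (Lp : IwasawaAlgebra p), IsQuadraticBranchPlusLFunction f p ϖ Lp →
      ∀ D : EtaSignedSelmerDualData V κ K₀ ℚ_[p] η γ 1, D.charIdeal = Ideal.span {Lp})
    (p : ℕ) [Fact p.Prime] (hp5 : 5 ≤ p) : LowerHalfOnType p (.Istar 0) := by
  intro W _ _ hT hr
  obtain ⟨hmod, hGZ, hGZK, hPT, hnf, hM⟩ := h₆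
  exact (missingLowerBoundAt_of_hasSignedLocalType_IstarZero_of_valuation_of_etaEvenMC W p hmod hGZ hGZK hPT
    hnf hM hKO h74 hC1K (h₁ p hp5 W hT hr) hT hr hp5).1

end Summit.BirchSwinnertonDyer.BirchSwinnertonDyer.Theorems.KFormReadings

end
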